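import Mathlib.MeasureTheory.Function.LpSeminorm.Basic
import Literature.Analysis.FunctionSpaces.FlatTorus
import Literature.Analysis.FunctionSpaces.TorusSobolevNorm
import HarnessLib

/-!
# Negative Sobolev norm of functions with vanishing cell averages on the flat torus

Analysis/FunctionSpaces support file (notion `flat_torus_T3` / `sobolev_torus_Hs`). It records,
as a named fact to be discharged, the standard estimate behind every "mixing to scale `h`"
statement (e.g. Bruè–De Lellis 2023, Thm. 4.1 (b), third line, from the patching (4.3) + (ii);
Alberti–Crippa–Mazzucato 2019, §6.4): if a square-integrable `f` on `T^d = ℝ^d/ℤ^d` has zero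
average on every cell `m/N + N⁻¹[0,1)^d` of the grid of mesh `h = N⁻¹`, then
`‖f‖_{Ḣ⁻¹(T^d)} ≤ C(d) h ‖f‖_{L²(T^d)}`.

Proof to be formalised (one paragraph): for a finite set `S ⊆ ℤ^d ∖ {0}` put
`g_S := Σ_{k ∈ S} |k|⁻² f̂(k) e_k`; then `Σ_{k∈S} |k|⁻²|f̂(k)|² = ∫ f ḡ_S = Σ_Q ∫_Q f (ḡ_S - ḡ_{S,Q})`
(cell averages of `f` vanish) `≤ ‖f‖_{L²} · C_P h ‖∇g_S‖_{L²}` by Cauchy–Schwarz and the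
Poincaré–Wirtinger inequality on cubes of side `h` (`‖g - g_Q‖_{L²(Q)} ≤ √d · h ‖∇g‖_{L²(Q)}`,
elementary, by the fundamental theorem of calculus along coordinate segments), while
`‖∇g_S‖²_{L²} = 4π² Σ_{k∈S} |k|⁻²|f̂(k)|²` by orthonormality of the characters; hence
`Σ_{k∈S} |k|⁻²|f̂(k)|² ≤ 4π² C_P² h² ‖f‖²_{L²}` for every finite `S`, and one takes the supremum.
Only finite sums of characters enter (no Parseval / Fourier inversion is needed).

## Lean rendering

* The cell `m/N + N⁻¹[0,1)^d ⊆ ℝ^d`, `m ∈ ℤ^d`, is written with the accepted `Torus.unitCube`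
  and `Torus.latticeVec` as `{y | (N : ℝ) • y - latticeVec m ∈ unitCube d}`; the cell average
  of `f : T^d → ℝ` is the integral over that subset of `ℝ^d` of the lift `f ∘ proj` (for
  `m ∈ {0,…,N-1}^d` these cells tile the fundamental cube `[0,1)^d`, on which `proj` is
  measure preserving, `Torus.measurePreserving_proj_unitCube`).
* `Ḣ⁻¹` is the accepted `Torus.eHomSobolevSeminorm (-1)` of `f` viewed in `ℂ`
  (`(Σ_{k ≠ 0} |k|⁻² |f̂(k)|²)^{1/2}`, characters `e^{2πik·x}`), `‖f‖_{L²}` is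
  `eLpNorm f 2 volume`; the constant `C` depends only on `d`.

## References

* E. Bruè, C. De Lellis, Comm. Math. Phys. 400 (2023), Thm. 4.1 (b) with (4.3), §4.1 (ii)
  (arXiv:2207.06301, p. 9) — the use of the estimate.
* G. Alberti, G. Crippa, A. L. Mazzucato, J. Amer. Math. Soc. 32 (2019), §6.4, (6.x)
  "decay of the functional mixing norm" (arXiv:1605.02090) — the planar `Ḣ^{-r}` analogue.
-/

noncomputable section

open MeasureTheory Set
open scoped ENNReal

namespace Literature.Analysis.FunctionSpaces

namespace Torus

variable (d : Type*) [Fintype d] [DecidableEq d]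

/-- **Vanishing cell averages force a small `Ḣ⁻¹` norm** (standard; the estimate behind
Bruè–De Lellis 2023, Thm. 4.1 (b), third line). There is a constant `C = C(d)` such that for
every mesh `N ≥ 1` and every `f ∈ L²(T^d; ℝ)` whose average over each grid cell
`m/N + N⁻¹[0,1)^d` (`m ∈ ℤ^d`; computed on the lift `f ∘ proj`) vanishes,
`‖f‖_{Ḣ⁻¹(T^d)} ≤ (C/N) ‖f‖_{L²(T^d)}`. Proof: duality against the finite trigonometric sums
`Σ_{k∈S} |k|⁻² f̂(k) e_k` and the Poincaré–Wirtinger inequality on the cells (module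
docstring). [folklore] -/
def eHomSobolevSeminorm_neg_one_le_of_cellAverage_eq_zero : Prop :=
  ∃ C : ℝ, ∀ (N : ℕ), 0 < N → ∀ f : UnitAddTorus d → ℝ, MemLp f 2 volume →
    (∀ m : d → ℤ,
      ∫ y in {y : EuclideanSpace ℝ d | (N : ℝ) • y - latticeVec m ∈ unitCube d}, f (proj y) = 0) →
    eHomSobolevSeminorm (-1) (fun x => (f x : ℂ)) ≤
      ENNReal.ofReal (C / N) * eLpNorm f 2 volume

end Torus

end Literature.Analysis.FunctionSpaces

end
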